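import Literature.MathematicalPhysics.QuantumFieldTheory.Balaban1983to89.Node00.OpsYDeltaPrimeA
import Literature.MathematicalPhysics.QuantumFieldTheory.Balaban1983to89.B6Dg288ChartV1

/-!
# `Balaban1983to89.Node00.OpsYDeltaA` — T. Bałaban, *Propagators for lattice gauge theories in a background field*, Commun. Math. Phys. **99**
# (1985) 389–434 [Balaban1985BackgroundPropagators], (3.3)–(3.4) pp. 390–391, (3.8)–(3.10) p. 392, (3.12)–(3.14) p. 393, (3.21)–(3.27) pp. 394–395,
# (3.48) p. 398: THE GENUINE COVARIANT LETTERS `Δ_a(U)`, `G(U) = Δ_a(U)⁻¹` AND `C(U) = (Q′G′²Q′*)⁻¹(U)` OF NODE 00's OPERATOR LAYER — def-Y's v2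
# letter family `covLettersY_v2`, THE PRINTED `U = 1` CLAUSES `GA_one` ∕ `C_one` OF `Node00.CovLettersY` PROVED, and the `OpsY` INSTANCE OF
# RECORD `opsYOfRecord N θ M⋆ 𝔈 := opsYOfLetters N θ M⋆ (lettersYOfRecord N θ M⋆) 𝔈`

statement-level skeleton of published theorems with citation tags; proofs where landed; nothing here is a claim about the Yang–Mills mass gap

PDF held: `paper:balaban1985-cmp99-background-propagators` (journal page = PDF page + 388); pp. 390–395, 398 read from the held text (`lit read … --pages
4-10`) and, for the formulas the OCR garbles ((3.2), (3.4), (3.10)), from the verbatim transcription in the tree file `B9Eq310DeltaPrime` (page renders).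
[4] = [Balaban1984PropagatorsII] (Commun. Math. Phys. **96** (1984) 223–250), typed in this topic as p21 (`B6Ineq288MultiLevelTorus`: `GT, QM, QsM, GiM,
pM, rM`), T8 (`B6Prop23KLevelTorusCensus`: `XopT, GinvT, CinvTP`) and r03 (`B6SectAOperatorsV1` ∕ `B6SectAVectorModelV1`: `dE, dsE, dcE, dcsE, QE, QsE,
aE, RE, deltaAE`; `B6Prop26Census2136KLevelV1.Gop = Δ_a⁻¹`).

THE PRINT.
* p. 390, (3.3): the covariant derivative `(D_U λ)(⟨x, x′⟩) = η⁻¹(R(U(x, x′))λ(x′) − λ(x))`, `R(U)X = UXU⁻¹`; p. 391, (3.4): *«(D^η_{U}A)(p) = η⁻¹(A(x, y)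
  + R(U(x, y))A(y, z) + R(U(x, w))A(z, w) + A(w, x)) for a plaquette p = ⟨x, y, z, w⟩»*, (3.5) *«U(x, x′) = U⁻¹(x′, x), A(x, x′) = −A(x′, x)»*;
  p. 390, (3.2): the transported edge variables *«A′(z, w) = R(U₀(x, w))A(z, w), A′(w, x) = A(w, x), A′(x, y) = A(x, y), A′(y, z) = R(U₀(x, y))·A(y, z),
  and ≺ denotes a natural ordering among bonds of the oriented contour ∂(p)_z = ⟨z, w⟩ ∪ ⟨w, x⟩ ∪ ⟨x, y⟩ ∪ ⟨y, z⟩»*.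
* p. 392, (3.8): *«(D*A)(x) = Σ_μ η⁻¹(R(U(x, x−ηe_μ))A(x−ηe_μ, x) − A(x, x+ηe_μ))»* (the adjoint for the pairing `X·Y = tr XY` of p. 392: TRANSPOSED
  flat kernel, INVERTED transporters — `R(U(x, x−ηe_μ)) = R(U(⟨x−ηe_μ, x⟩))⁻¹` by (3.5)); (3.9): the adjoint `D*` on plaquette functions, same shape;
  (3.10): *«⟨A, ΔA⟩ = ⟨A, D*DA⟩ + ⟨A, Δ′A⟩, ⟨A, Δ′A⟩ = Σ_{p⊂T_η} η^d tr((D¹_U A)(p))²η⁻²(Re U(∂p) − 1) + tr Σ_{b₁,b₂⊂∂(p)_z, b₁≺b₂} i[A′(b₁), A′(b₂)]η⁻²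
  Im U(∂p)»*, `Re U(∂p) = ½(U(∂p) + U(∂p)⁻¹)`, `Im U(∂p) = (1/2i)(U(∂p) − U(∂p)⁻¹)` (p. 391, complexified reading).
* p. 394, (3.21): *«R = R(U) is an orthogonal projection in the Hilbert space L²(Ω₀, 𝔤) onto the subspace ℛ = Δ^η_U N(Q′), N(Q′) = {λ : Q′λ = 0}»*;
  (3.25): *«Rf = (I − G′Q′*(Q′G′²Q′*)⁻¹Q′G′)f, where G′ = G′(U) = (Δ′_a)⁻¹. We do not know yet if the operators in the above formula are well
  defined. Assuming some regularity of the configuration U it can be easily shown that the operator Δ′_a is positive. This implies positivity of the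
  operators G′, Q′G′²Q′*, hence the existence of the operator R.»*
* p. 395, (3.26): *«Δ_a(U) = Δ(U) + D_U R(U) D*_U + Q*(U)aQ(U), or simply Δ_a = Δ + DRD* + Q*aQ. It coincides with Δ_a in (2.19) if U = 1.»*; (3.27):
  *«we denote its inverse again by G, or G(U) … G(U) = G = (Δ_a|Ω₀)⁻¹»*.
* p. 398, Thm 3.2, (3.48): the kernel `(Q′(U)G′²(U)Q′*(U))⁻¹(y, y′)`, `y ∈ Λ_j, y′ ∈ Λ_{j′}` — the object the layer's letter `C` names; Cor. 3.5 p. 407: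
  *«for U = 1 these theorems are proved in [4]»*.

WHY THIS FILE (cell context).  `Node00.OpsYOfLetters` (p464552) made NODE 00's operator layer a FUNCTION of a record of letters `CovLettersY 𝔸 x`
whose `Prop` fields are the printed `U = 1` clauses, and inhabited it by the FLAT family; `Node00.OpsYTransport` (p471880) supplied the genuine
taxicab transporters `parSY ∕ parBY`, `Node00.OpsYDeltaPrimeA` (p473950) the genuine `G′(U) = (Δ′_a(U))⁻¹` with its clause `Gp_one`.  This file
supplies the two remaining covariant letters the N06 knit consumes — `GA := G(U) = Δ_a(U)⁻¹` ((3.26)–(3.27)) and `C := (Q′G′²Q′*)⁻¹(U)` ((3.25), (3.48))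
— as GENUINE functions of the background `U`, PROVES their printed `U = 1` clauses `GA_one` ∕ `C_one` from the record's `parS_one ∕ parB_one ∕ Gp_one`,
assembles def-Y's v2 family `covLettersY_v2 = ((covLettersY_flat.withTransport).withGp).withGAC`, and names THE LETTERS ∕ `OpsY` INSTANCE OF RECORD
(`lettersYOfRecord`, `opsYOfRecord`) at which the dag-n06 knit `BalabanUVNodesN06AtLettersYOfRecord` instantiates.

DESIGN (one shape for every letter).  Every flat kernel is BY DEFINITION the matrix `LinearMap.toMatrix' (onFun <r03 operator>)` of the corresponding
operator of [4] Sect. A (site slots re-indexed by the chart `boxEquiv`), resp. p21's ∕ T8's matrix read on the Y carriers (§2); every covariant letter is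
the TRANSPORTED LIFT `trLiftY kernel T(U)` (§1): `(M♯_T Λ)(y) = Σ_x M(y, x) • R(T(y, x))Λ(x)` with print's transporters — (3.3): the far end `λ(x′)` of
`D_U` carried by `U(⟨x, x′⟩)`; (3.4)/(3.2): the edges `⟨y, z⟩ = ⟨x+e_μ, ν⟩`, `⟨z, w⟩ ∼ ⟨x+e_ν, μ⟩` of `p_{μν}(x)` carried by `U_μ(x)`, `U_ν(x)`; the adjoints
(3.8)/(3.9) and `Q*`, `Q′*`: transposed kernel, inverted transporters; `Q(U)`, `Q′(U)` ((3.12)–(3.14)): the record's bond ∕ site transporters `parB ∕ parS`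
from the bond's source to the base site of its index bond ∕ the corner of its block.  At `U = 1` every transporter is `1` and each letter IS the plain
lift `liftMatY kernel` (§5), so the printed clauses reduce to the matrix algebra of [4]: `toMatrix_XopT`, `toMatrix_GinvT`, `rM = 1 − pM`, r03's
`deltaAE_def : Δ_a = ∂ᶜ*∂ᶜ + ∂R∂* + Q*aQ` and gen-19's `RE_eq_rM_chart` (Sect. A's `R` IS p21's `1 − P` through the chart), here in
KERNEL (`*ᵥ`) form on the Y carriers (`onFun_deltaAE_eq`); the same identifications in OPERATOR form, and sockets of the exact types of
`CovLettersY.GA_one ∕ C_one`, are dag-n06-g's `B9Eq326AtOneChart` (p478527 ∕ p481828: `onFun_deltaAE_kIdx`, `GA_one_of_summands`,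
`C_one_of_ringInverse_QGGQs`) — an alternative feed for other letter constructions; nothing of it is restated here.
THE HESSIAN (3.10) AS AN OPERATOR.  For the bilinear trace pairing `⟨A, B⟩ = Σ_b tr A(b)B(b)` (both sides carry the same `η^d`, which cancels from the
operator): `tr((DA)(p)·½{(DA)(p), Re U(∂p)}) = tr((DA)(p))² Re U(∂p)` (cyclicity), so `D*D + Δ′₁ = D* ∘ 𝒥_U ∘ D` with the Jordan insertion
`(𝒥_U F)(p) = ½(F(p)·Re U(∂p) + Re U(∂p)·F(p))` (`jordanY`); and with `A′_m = σ_m R(T_m)A(b_m)` (`b_m`, `σ_m = (−,−,+,+)`, `T_m = (U_ν(x), 1, 1, U_μ(x))` the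
edges of `∂(p)_z` in the order `≺`, `edgeY ∕ sgnY ∕ edgeParY`) and `M_p = η⁻² Im U(∂p)`, `tr(B′_m · i[X, M_p]) = tr(i[B′_m, X] M_p)` gives the polarized
second term as the operator `(Δ′₂A)(b) = ½ Σ_p Σ_{m : b_m = b} σ_m R(T_m)⁻¹ i[ Σ_{l ≻ m} A′_l − Σ_{l ≺ m} A′_l , M_p ]` (`curv2Y`; `R(V)` is orthogonal for
the pairing: `tr(R(V)X · Y) = tr(X · R(V⁻¹)Y)`).  `hessY U := coCurlY U ∘ jordanY U ∘ curlY U + curv2Y U`; at `U = 1`: `Re = 1`, `Im = 0`, `hessY 1 =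
∂ᶜ*♯ ∘ ∂ᶜ♯` (`hessY_one`) — «generalizing the operator ∂*∂».

WHAT IS DEFINED AND PROVED (sorry-free; no `Prop` placeholder; no inequality of the paper).
* §1 `trLiftY M T` (transported rectangular lift), `liftMatY 𝔸 M` (plain rectangular lift; `liftOpY`, `liftEndY`, `kernelOpY` of `OpsYOfLetters` are
  its square cases, `rfl`), `trLiftY_eq_liftMatY_of_one`, `liftMatY_liftY` (`M♯(f ⊗ E) = (M f) ⊗ E`), `liftMatY_mul ∕ _add ∕ _sub ∕ _one`; `RL V` (`R(V)` as a
  ℂ-linear map) and the covariance engine **`trLiftY_gauge`** (`M♯_{T′}(R(g_X)Λ) = R(g_Y)(M♯_T Λ)` when `T′ = g_Y·T·g_X⁻¹` on the kernel's support).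
* §2 carriers `PlaqY`; flat kernels `gradK, divK, curlK, cocurlK, qK, qsK, aK` (matrices of r03's `dE, dsE, dcE, dcsE, QE, QsE, aE` at the index's
  `c_f`, `w`), the Y-typed aliases `qpK = QM`, `qpsK = QsM`, `gpK = (toKT i).G = GT`, `xinvK = GiM`, `rK = rM` (`rK_eq_one_sub : R♯ = 1 −
  G′Q′*(Q′G′²Q′*)⁻¹Q′G′`, `rfl`), `cK = CinvTP.ker`, `XopEY = XopT`, `XinvEY = GinvT` with `toMatrix_XopEY`, `toMatrix_XinvEY`, `XopEY_isUnit`,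
  `XopEY_comp_XinvEY`, `cK_eq_xinvK_mul`; the adjoint structure `divK_eq_transpose`, `cocurlK_eq_transpose`, `qsK_eq_transpose` (`∂* = ∂ᵀ`, …: r03's
  adjoints in orthonormal coordinates, `toMatrix'_onFun_adjoint`); the block anchor `blkCornerY`; transporter assignments `gradT` (3.3), `curlT` (3.4)/(3.2), `qT`, `qpT`.
* §3 THE LETTERS: `gradY U = D_U` (3.3), `divY U = D*_U` (3.8), `curlY U` (3.4), `coCurlY U` (3.9), `QY ∕ QsY parB U` (3.12)–(3.13) and adjoint, `aY`,
  `QpY ∕ QpsY parS U` (3.14)/(3.24) and adjoint; (3.8)/(3.9)/(3.13) BY NAME: `divY_eq_transpose`, `coCurlY_eq_transpose`, `QsY_eq_transpose`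
  (adjoint letter = transported lift of the TRANSPOSED kernel along the INVERTED transporters); `holY` (`U(∂p)`), `reHolY`, `imHolY` (p. 391), `jordanY`, `edgeY`,
  `sgnY`, `edgeParY`, `primeEdgeY` (`A ↦ A′(b_m)`), `commY M` (`X ↦ i[X, M]`), `curv2Y`, **`hessY U = Δ(U)`** (3.10).
* §4 **`XY parS Gp U = Q′(U)G′(U)²Q′*(U)`**, `XinvY := Ring.inverse (XY …)`, **`RY = R(U) = I − G′Q′*(Q′G′²Q′*)⁻¹Q′G′`** (3.25), `cWtY` (print's units
  `η^{−4−(d+1)} ∕ (L^jη)^{d+1}` of T8's `CinvTP`), **`CY parS Gp U = (Q′G′²Q′*)⁻¹(U)`** as the operator whose δ-matrix is the (3.48) kernel in print's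
  units, **`deltaAY parS parB Gp U = Δ_a(U) = Δ(U) + D_U R(U) D*_U + Q*(U)aQ(U)`** (3.26), **`GAY parS parB Gp U = G(U) := Ring.inverse (Δ_a(U))`**
  (3.27).
* §5 AT `U = 1`: `gradY_one, divY_one, curlY_one, coCurlY_one, QY_one, QsY_one, QpY_one, QpsY_one` (each letter = the lift of its flat kernel),
  `holY_one, reHolY_one, imHolY_one, jordanY_one (= id), curv2Y_one (= 0)`, **`hessY_one`**, `Gp_one_eq_liftMatY`, **`XY_one`** (`= XopT♯`),
  **`XinvY_one`** (`= GiM♯`: the `Ring.inverse` is T8's inverse since `XopT` is a unit), **`RY_one`** (`= rM♯`), **`CY_one`** (`= CinvTP♯`) and the clause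
  **`CY_one_deltaY`**; the flat identity `onFun_deltaAE_eq` (`Δ_a A = ∂ᶜ*∂ᶜA + ∂R∂*A + Q*aQA` in kernel form, via `divK_mulVec`, `gradK_mulVec`,
  `onFun_RE_apply`, `gradK_rK_divK_mulVec`), **`deltaAY_one_liftY ∕ deltaAY_one`** («coincides with Δ_a in (2.19) if U = 1»), the clause
  **`GAY_one_liftY`** and `GAY_one` (`G(1) = Gop♯`, n06-g's engine `GA_one_of_ringInverse_deltaA_one`), `deltaAY_mul_GAY ∕ GAY_mul_deltaAY` (genuine
  inverse wherever `Δ_a(U)` is a unit), `isUnit_deltaAY_one`.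
* §6 `CovLettersY.withGAC` (replace `GA`, `C` by the genuine letters over the record's own `parS, parB, Gp`; clauses discharged by §5) with `rfl` field
  lemmas; **`covLettersY_v2 𝔸 x := (covLettersY_TGp 𝔸 x).withGAC 𝔸`** and `covLettersY_v2_GA ∕ _C ∕ _Gp ∕ _parS ∕ _parB`.
* §7 **`lettersYOfRecord N θ M⋆ : LettersY N θ M⋆`** (`x ↦ covLettersY_v2 (M_N(ℂ)) x`), **`opsYOfRecord N θ M⋆ 𝔈 : OpsY N θ M⋆`**, `opsYOfRecord_eq`,
  `lettersYOfRecord_apply`, `Y9OfRecord_opsYOfRecord`.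

MODEL ∕ DECLARED READINGS.  (M1) fibre: any complete normed ℂ-algebra `𝔸` (the record: `M_N(ℂ) ⊇ u(N)ᶜ`), `U` with values in `𝔸ˣ`, `R(V)X = VXV⁻¹`
(`B9Eq39Adjoint.R`); carriers, chart and scale factors `c_f`, weights `w`, `a` of the [B6] census member (`Node00.CarriersB6K`, `OpsYOfLetters`), fine
lattice = the member's periodic lattice `PV`, so print's Dirichlet restriction `|Ω₀` is the identity here (Ω₀ = the member's torus), exactly as in the
flat clause `G(1) = Gop = Δ_a⁻¹` of r03.  (M2) TRANSPORT CONTOURS of `Q(U)`, `Q′(U)` ((3.12)–(3.14), [5] (78)–(80)): the record's taxicab transporters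
`parB ∕ parS` (`Node00.OpsYTransport`, its declared P2 divergence from print's straight contours), anchored at the source of the index bond (embedded to
level 0 by `B15DeterminingSets.embIter`) ∕ at the block's corner `blkCornerY`.  (M3) INVERSES: `G′`, `(Q′G′²Q′*)⁻¹`, `G` are `Ring.inverse`s — the genuine two-sided inverses
wherever the operators are units (print, p. 394: «We do not know yet if the operators in the above formula are well defined»); at `U = 1` they are
(`XopEY_isUnit`, `isUnit_deltaAY_one`), and the small-field invertibility is the content of Thms 3.1–3.4, NOT claimed here.  (M4) the Hessian is the
operator of the BILINEAR form (3.10) for the trace pairing (derivation above); hermiticity for unitary `U` and the `L²` structure of the fibre are not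
constructed.  (M5) NOT HERE: any estimate ((3.42)–(3.48), Thms 3.1–3.15), the gauge covariance (3.28)–(3.31) of the assembled letters (only its engine
`trLiftY_gauge` is), the expansion (3.6)–(3.7).
HONEST SCOPE.  Exact finite-dimensional lattice algebra realising the printed FORMULAS (3.3)–(3.4), (3.8)–(3.10), (3.25)–(3.27) as functions of `U` on
NODE 00's carriers, with the `U = 1` identifications PROVED against [4]'s typed objects; no inequality of the paper; NOT summit progress (route
BalabanUVNodes: N06 obligations are hypotheses of the knit).  Consumers: dag-n06-d's knit at `opsYOfRecord` (trigger (t3)), n06-c's frame rows 13 ∕ 13′,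
n06-g ∕ n06-h's `U = 1` rows (which keep their own names — nothing of theirs is restated: the lift calculus and the engines are IMPORTED from
`B9Cor35AtOneInverseLetters`).  Filed by the pub-ymgap def-Y owner lineage (`pub-ymgap-node00-def-Y`, gen 2); a NEW file; nothing landed is modified.
Net new unproved facts: 0.
-/

namespace Literature.MathematicalPhysics.QuantumFieldTheory.Balaban1983to89.Node00

open LatticeFieldCalculus (grad diverg curl)
open B4Reflection242 (boxDom)
open B6MultiLevelBoxOperator (aPrinted)
open B6KLevelCensusIndexV1 (KIdx)
open B6Prop22KLevelTorusCensus (KTIdx)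
open B6Prop22KLevelTorusCensusEta (nKT)
open B6Ineq2133TwoScaleV1 (onFun onFun_apply)
open B6SectAOperatorsV1 (BondIdx dE dsE dcE dcsE QE QsE aE RE dsE_eq_adjoint)
open B6SectAVectorModelV1 (deltaAE deltaAE_def)
open B6GlobalChartV1 (PV domT boxEquiv toBox)
open B6ScalarFactorsChartV1 (chartOp chartOp_apply onFun_eq_chartOp)
open B6Dg288ChartV1 (RE_eq_rM_chart)
open B6Ineq288MultiLevelTorus (GT QM QsM GiM pM rM toMatrix_XopT toMatrix_GinvT)
open B6Prop23KLevelTorusCensus (XopT XopT_mul_GinvT XopT_isUnit CinvTP CinvTP_ker)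
open B6Prop23MultiLevelTorus (GinvT)
open B6Prop23Chain (mat)
open B6Ineq268MultiLevelBox (W)
open B6Geom246MultiLevelBox (bset blkOf corner corner_mem)
open B6Prop26Census2136KLevelV1 (Gop)
open B6Cor28KLevelV1 (onFun_comp)
open B6AgreeLapV1Chart (onFun_add toMatrix'_onFun_adjoint)
open B15DeterminingSets (embIter)
open B9Eq39Adjoint (R R_one R_add R_smul R_mul R_zero R_inv_R)
open B9BackgroundsKLevelV1 (CfgV1)
open B9PinMembersKLevelV1 (MemberY)
open B9PinCarriersKLevelV1 (carriersY)
open B7Prop2SpecialUnitary (specialUnitaryUnits)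
open B9Cor35AtOneInverseLetters (linearMap_ext_of_liftY liftOpY_one liftOpY_mul eq_liftOpY_of_liftY eq_liftEndY_of_ringInverse
  GA_one_of_ringInverse_deltaA_one eq_liftEndY_Gop_of_ringInverse one_le_ell)
open scoped Matrix

noncomputable section

variable {d ℓ : ℕ} {hd : 1 ≤ d + 1} {hL : Odd (ℓ + 1) ∧ 1 < ℓ + 1} {b₀ b₁ : ℝ} {Mstar : ℕ}
variable {𝔸 : Type} [NormedRing 𝔸] [NormedAlgebra ℂ 𝔸] [CompleteSpace 𝔸]

/-! ## §1 Rectangular lifts of real matrices, with and without transport -/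

section General

variable {X Y Z : Type} [Fintype X] [Fintype Y] [Fintype Z]

/-- **THE TRANSPORTED LIFT of a real kernel** `M : Y × X → ℝ` along a transporter assignment `T(y, x) ∈ 𝔸ˣ`:
`(M♯_T Λ)(y) = Σ_x M(y, x) • R(T(y, x)) Λ(x)`, `R(V)X = VXV⁻¹` — the common shape of the covariant letters (3.3), (3.4), (3.8), (3.9), (3.12)–(3.14),
(3.21) (a flat nearest-neighbour ∕ averaging kernel whose distant argument is parallel-transported to the evaluation point); the rectangular twin of
`kernelTrOpY`. [cite: Balaban1985BackgroundPropagators, (3.3) p.390, (3.12)–(3.14) p.393, (3.21) p.394] -/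
def trLiftY (M : Matrix Y X ℝ) (T : Y → X → 𝔸ˣ) : (X → 𝔸) →ₗ[ℂ] (Y → 𝔸) where
  toFun Λ := fun y => ∑ x, ((M y x : ℝ) : ℂ) • R (T y x) (Λ x)
  map_add' Λ Λ' := by
    funext y
    simp only [Pi.add_apply, R_add, smul_add, Finset.sum_add_distrib]
  map_smul' c Λ := by
    funext y
    simp only [Pi.smul_apply, R_smul, RingHom.id_apply, Finset.smul_sum, smul_comm c]

omit [Fintype Y] [CompleteSpace 𝔸] in
/-- the transported lift, evaluated. [cite: Balaban1985BackgroundPropagators, (3.3) p.390, bookkeeping] -/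
theorem trLiftY_apply (M : Matrix Y X ℝ) (T : Y → X → 𝔸ˣ) (Λ : X → 𝔸) (y : Y) :
    trLiftY M T Λ y = ∑ x, ((M y x : ℝ) : ℂ) • R (T y x) (Λ x) := rfl

variable (𝔸)

/-- the ℂ-linear lift of a RECTANGULAR real matrix to `𝔸`-valued functions: `(M♯Λ)(y) = Σ_x M(y, x) • Λ(x)` (the flat faces of the letters).
[cite: Balaban1985BackgroundPropagators, p.395 («It coincides with Δ_a in (2.19) if U = 1»), dictionary] -/
def liftMatY (M : Matrix Y X ℝ) : (X → 𝔸) →ₗ[ℂ] (Y → 𝔸) where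
  toFun Λ := fun y => ∑ x, ((M y x : ℝ) : ℂ) • Λ x
  map_add' Λ Λ' := by
    funext y
    simp [smul_add, Finset.sum_add_distrib]
  map_smul' c Λ := by
    funext y
    simp [Finset.smul_sum, smul_comm c]

omit [Fintype Y] [CompleteSpace 𝔸] in
/-- the rectangular lift, evaluated. [cite: Balaban1985BackgroundPropagators, p.395, bookkeeping] -/
theorem liftMatY_apply (M : Matrix Y X ℝ) (Λ : X → 𝔸) (y : Y) : liftMatY 𝔸 M Λ y = ∑ x, ((M y x : ℝ) : ℂ) • Λ x := rfl

omit [CompleteSpace 𝔸] in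
/-- the square lift `liftOpY` IS the rectangular lift on a square matrix. [cite: Balaban1985BackgroundPropagators, p.395, bookkeeping] -/
theorem liftOpY_eq_liftMatY (A : Matrix X X ℝ) : liftOpY 𝔸 A = liftMatY 𝔸 A := rfl

omit [CompleteSpace 𝔸] in
/-- `liftEndY T` is the rectangular lift of the matrix of `T`. [cite: Balaban1985BackgroundPropagators, p.395, bookkeeping] -/
theorem liftEndY_eq_liftMatY [DecidableEq X] (T : Module.End ℝ (X → ℝ)) : liftEndY 𝔸 T = liftMatY 𝔸 (LinearMap.toMatrix' T) := rfl

omit [Fintype Y] [CompleteSpace 𝔸] in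
/-- with trivial transport the transported lift is the flat lift. [cite: Balaban1985BackgroundPropagators, p.395 («It coincides with Δ_a in (2.19) if U = 1»)] -/
theorem trLiftY_eq_liftMatY_of_one {M : Matrix Y X ℝ} {T : Y → X → 𝔸ˣ} (hT : ∀ y x, T y x = 1) : trLiftY M T = liftMatY 𝔸 M := by
  refine LinearMap.ext fun Λ => funext fun y => ?_
  simp only [trLiftY_apply, liftMatY_apply, hT, R_one]

omit [Fintype Y] [CompleteSpace 𝔸] in
/-- the rectangular lift acts on product-form arguments as the matrix: `M♯(f ⊗ E) = (M f) ⊗ E`. [cite: Balaban1985BackgroundPropagators, (3.39) p.397, bookkeeping] -/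
theorem liftMatY_liftY (M : Matrix Y X ℝ) (f : X → ℝ) (E : 𝔸) : liftMatY 𝔸 M (liftY f E) = liftY (M *ᵥ f) E := by
  funext y
  simp only [liftMatY_apply, liftY_apply, Matrix.mulVec, dotProduct]
  rw [show (((∑ x, M y x * f x : ℝ)) : ℂ) = ∑ x, ((M y x : ℝ) : ℂ) * ((f x : ℝ) : ℂ) by push_cast; rfl, Finset.sum_smul]
  refine Finset.sum_congr rfl fun x _ => ?_
  rw [mul_smul]

omit [CompleteSpace 𝔸] [Fintype Z] in
/-- the rectangular lift is multiplicative: `(M·N)♯ = M♯ ∘ N♯`. [cite: Balaban1985BackgroundPropagators, p.395, bookkeeping] -/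
theorem liftMatY_mul (M : Matrix Z Y ℝ) (N : Matrix Y X ℝ) : liftMatY 𝔸 (M * N) = liftMatY 𝔸 M ∘ₗ liftMatY 𝔸 N := by
  refine linearMap_ext_of_liftY fun f E => ?_
  rw [LinearMap.comp_apply, liftMatY_liftY, liftMatY_liftY, liftMatY_liftY, Matrix.mulVec_mulVec]

omit [Fintype Y] [CompleteSpace 𝔸] in
/-- the rectangular lift is additive. [cite: Balaban1985BackgroundPropagators, p.395, bookkeeping] -/
theorem liftMatY_add (M N : Matrix Y X ℝ) : liftMatY 𝔸 (M + N) = liftMatY 𝔸 M + liftMatY 𝔸 N := by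
  refine linearMap_ext_of_liftY fun f E => ?_
  rw [LinearMap.add_apply, liftMatY_liftY, liftMatY_liftY, liftMatY_liftY, Matrix.add_mulVec, liftY_add]

omit [Fintype Y] [CompleteSpace 𝔸] in
/-- the rectangular lift is subtractive. [cite: Balaban1985BackgroundPropagators, p.395, bookkeeping] -/
theorem liftMatY_sub (M N : Matrix Y X ℝ) : liftMatY 𝔸 (M - N) = liftMatY 𝔸 M - liftMatY 𝔸 N := by
  rw [eq_sub_iff_add_eq, ← liftMatY_add, sub_add_cancel]

omit [CompleteSpace 𝔸] in
/-- the lift of `1` is the identity. [cite: Balaban1985BackgroundPropagators, p.395, bookkeeping] -/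
theorem liftMatY_one [DecidableEq X] : liftMatY 𝔸 (1 : Matrix X X ℝ) = LinearMap.id := by
  rw [← liftOpY_eq_liftMatY, liftOpY_one]

variable {𝔸}

/-- the adjoint action as a ℂ-linear map. [cite: Balaban1985BackgroundPropagators, (3.1) p.390 («R(U)X = UXU⁻¹»), bookkeeping] -/
def RL (V : 𝔸ˣ) : 𝔸 →ₗ[ℂ] 𝔸 where
  toFun := R V
  map_add' := R_add V
  map_smul' c X := R_smul V c X

omit [CompleteSpace 𝔸] [Fintype Y] in
/-- ★ THE COVARIANCE ENGINE behind (3.28) («obvious for the operators `D_U`, …»): if the transporters transform under a gauge transformation as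
`T′(y, x) = g_Y(y)·T(y, x)·g_X(x)⁻¹` wherever the kernel is non-zero, the transported lift intertwines the conjugations —
`M♯_{T′}(R(g_X)Λ)(y) = R(g_Y(y))·(M♯_T Λ)(y)`. (The gauge covariance (3.28)–(3.31) of the letters below is thereby reduced, letter by letter, to the
transformation laws of their transporter tables; that reduction is NOT carried out in this file.) [cite: Balaban1985BackgroundPropagators, (3.28) p.395] -/
theorem trLiftY_gauge (M : Matrix Y X ℝ) (T T' : Y → X → 𝔸ˣ) (gX : X → 𝔸ˣ) (gY : Y → 𝔸ˣ)
    (hT : ∀ y x, M y x ≠ 0 → T' y x = gY y * T y x * (gX x)⁻¹) (Λ : X → 𝔸) (y : Y) :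
    trLiftY M T' (fun x => R (gX x) (Λ x)) y = R (gY y) (trLiftY M T Λ y) := by
  rw [trLiftY_apply, trLiftY_apply]
  have hR : R (gY y) (∑ x, ((M y x : ℝ) : ℂ) • R (T y x) (Λ x)) = ∑ x, R (gY y) (((M y x : ℝ) : ℂ) • R (T y x) (Λ x)) :=
    map_sum (RL (gY y)) _ _
  rw [hR]
  refine Finset.sum_congr rfl fun x _ => ?_
  by_cases hM : M y x = 0
  · simp [hM]
  · rw [R_smul, hT y x hM, B9Eq39Adjoint.R_mul, B9Eq39Adjoint.R_mul, R_inv_R]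

end General

/-! ## §2 Carriers, the flat kernels (matrices of r03's operators of (2.19)) and the printed transporter assignments -/

section Letters

variable (i : KIdx d ℓ hd hL b₀ b₁)

/-- the fine positively oriented PLAQUETTES at an index. [cite: Balaban1985BackgroundPropagators, (3.1) p.390, dictionary] -/
abbrev PlaqY (i : KIdx d ℓ hd hL b₀ b₁) : Type := Plaq (PV d ℓ i.m i.K hd hL) 0

/-- the flat kernel of the GRADIENT `∂ : sites → bonds` (physical units `c_f`), site slot read on NODE 00's box chart: the matrix of r03's `dE c_f`.
[cite: Balaban1985BackgroundPropagators, (3.3) p.390; Balaban1984PropagatorsII, (2.19) p.226, dictionary] -/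
def gradK : Matrix (FBondY i) (SiteY i) ℝ :=
  (LinearMap.toMatrix' (onFun (dE (P := PV d ℓ i.m i.K hd hL) i.cf))).submatrix id (boxEquiv i.hN).symm

/-- the flat kernel of the DIVERGENCE `∂* : bonds → sites`: the matrix of r03's `dsE c_f`.
[cite: Balaban1985BackgroundPropagators, (3.8) p.392; Balaban1984PropagatorsII, (2.19) p.226, dictionary] -/
def divK : Matrix (SiteY i) (FBondY i) ℝ :=
  (LinearMap.toMatrix' (onFun (dsE (P := PV d ℓ i.m i.K hd hL) i.cf))).submatrix (boxEquiv i.hN).symm id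

/-- the flat kernel of the CURL `∂ : bonds → plaquettes`: the matrix of r03's `dcE c_f`.
[cite: Balaban1985BackgroundPropagators, (3.4) p.391; Balaban1984PropagatorsII, (2.19) p.226, dictionary] -/
def curlK : Matrix (PlaqY i) (FBondY i) ℝ := LinearMap.toMatrix' (onFun (dcE (P := PV d ℓ i.m i.K hd hL) i.cf))

/-- the flat kernel of the CO-CURL `∂* : plaquettes → bonds` (the adjoint): the matrix of r03's `dcsE c_f`.
[cite: Balaban1985BackgroundPropagators, (3.9) p.392; Balaban1984PropagatorsII, (2.19) p.226, dictionary] -/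
def cocurlK : Matrix (FBondY i) (PlaqY i) ℝ := LinearMap.toMatrix' (onFun (dcsE (P := PV d ℓ i.m i.K hd hL) i.cf))

/-- the flat kernel of the BOND AVERAGING `Q : bonds → coarse bonds`: the matrix of r03's `QE`.
[cite: Balaban1985BackgroundPropagators, (3.12)–(3.14) p.393; Balaban1984PropagatorsII, (2.20) p.226, dictionary] -/
def qK : Matrix (IBondY i) (FBondY i) ℝ := LinearMap.toMatrix' (onFun (QE (domT i.hN i.D i.hk)))

/-- the flat kernel of `Q*`: the matrix of r03's `QsE`. [cite: Balaban1985BackgroundPropagators, (3.13) p.393; Balaban1984PropagatorsII, (2.19) p.226, dictionary] -/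
def qsK : Matrix (FBondY i) (IBondY i) ℝ := LinearMap.toMatrix' (onFun (QsE (domT i.hN i.D i.hk)))

/-- the weight operator `a` (multiplication by the printed weights `a_j(L^jη)^{−2}`, r03's `aE … i.w`) as a matrix.
[cite: Balaban1985BackgroundPropagators, (3.26) p.395; Balaban1984PropagatorsII, (2.19) p.226, dictionary] -/
def aK : Matrix (IBondY i) (IBondY i) ℝ := LinearMap.toMatrix' (onFun (aE (domT i.hN i.D i.hk) i.w))

/-- (3.8) at the level of flat kernels: THE DIVERGENCE KERNEL IS THE TRANSPOSE OF THE GRADIENT KERNEL (`∂* = ∂ᵀ` — r03's `dsE` is the adjoint of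
`dE`, and adjoint = transpose in the orthonormal site ∕ bond coordinates). [cite: Balaban1985BackgroundPropagators, (3.8) p.392; Balaban1984PropagatorsII, (2.7)–(2.8) p.224] -/
theorem divK_eq_transpose : divK i = (gradK i)ᵀ := by
  rw [divK, gradK, Matrix.transpose_submatrix, dsE_eq_adjoint, toMatrix'_onFun_adjoint]

/-- (3.9) at the level of flat kernels: the co-curl kernel is the transpose of the curl kernel. [cite: Balaban1985BackgroundPropagators, (3.9) p.392] -/
theorem cocurlK_eq_transpose : cocurlK i = (curlK i)ᵀ := by
  unfold cocurlK curlK dcsE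
  exact toMatrix'_onFun_adjoint _

/-- (3.13): the `Q*` kernel is the transpose of the `Q` kernel. [cite: Balaban1985BackgroundPropagators, (3.13) p.393; Balaban1984PropagatorsII, (2.18) p.226] -/
theorem qsK_eq_transpose : qsK i = (qK i)ᵀ := by
  unfold qsK qK QsE
  exact toMatrix'_onFun_adjoint _

/-! ### p21's ∕ T8's flat site ∕ block objects READ ON THE Y CARRIERS (definitionally the same objects; the aliases pin the index types
`SiteY i ∕ BlkY i`, which p21 writes as `↥(boxDom (N0 …))` ∕ `↥(bset i.D.toDomains)` and T8 through `toKT i`) -/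

/-- `Q′♯` — p21's block-averaging matrix `QM` on the Y carriers. [cite: Balaban1984PropagatorsII, (2.14) p.225, dictionary] -/
def qpK : Matrix (BlkY i) (SiteY i) ℝ := QM i.D

/-- `Q′*♯` — p21's `QsM` on the Y carriers. [cite: Balaban1984PropagatorsII, (2.69) p.235, dictionary] -/
def qpsK : Matrix (SiteY i) (BlkY i) ℝ := QsM i.D

/-- `G′♯` — NODE 00's site propagator matrix `(toKT i).G` (= p21's `GT i.D`) on the Y carriers. [cite: Balaban1984PropagatorsII, (2.7) p.224, dictionary] -/
def gpK : Matrix (SiteY i) (SiteY i) ℝ := (toKT i).G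

/-- `(Q′G′²Q′*)⁻¹♯` — T8's matrix `GiM` on the Y carriers. [cite: Balaban1984PropagatorsII, (2.86)–(2.87) p.238, dictionary] -/
def xinvK : Matrix (BlkY i) (BlkY i) ℝ := GiM i.D

/-- `R♯ = 1 − P` — p21's `rM` on the Y carriers. [cite: Balaban1984PropagatorsII, (2.17) p.225, dictionary] -/
def rK : Matrix (SiteY i) (SiteY i) ℝ := rM i.D

/-- `C♯` — T8's printed-unit kernel `CinvTP` on the Y carriers. [cite: Balaban1984PropagatorsII, (2.87) p.238, dictionary] -/
def cK : BlkY i → BlkY i → ℝ := fun s s' => (CinvTP (toKT i)).ker s s'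

/-- `Q′G′²Q′*` of the member (T8's `XopT`) as an endomorphism of the Y block functions. [cite: Balaban1984PropagatorsII, (2.69) p.235, dictionary] -/
def XopEY : Module.End ℝ (BlkY i → ℝ) := XopT (toKT i)

/-- its inverse `GinvT` (T8) as an endomorphism of the Y block functions. [cite: Balaban1984PropagatorsII, (2.86) p.238, dictionary] -/
def XinvEY : Module.End ℝ (BlkY i → ℝ) := GinvT i.D (aPrinted ℓ 1)

/-- the alias is p21's `QM`. [cite: Balaban1984PropagatorsII, (2.14) p.225, bookkeeping] -/
theorem qpK_eq : qpK i = QM i.D := rfl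

/-- the alias is p21's `QsM`. [cite: Balaban1984PropagatorsII, (2.69) p.235, bookkeeping] -/
theorem qpsK_eq : qpsK i = QsM i.D := rfl

/-- the alias is NODE 00's `G`. [cite: Balaban1984PropagatorsII, (2.7) p.224, bookkeeping] -/
theorem gpK_eq : gpK i = (toKT i).G := rfl

/-- … and p21's `GT`. [cite: Balaban1984PropagatorsII, (2.7) p.224, bookkeeping] -/
theorem gpK_eq_GT : gpK i = GT i.D := rfl

/-- the alias is T8's `GiM`. [cite: Balaban1984PropagatorsII, (2.86) p.238, bookkeeping] -/
theorem xinvK_eq : xinvK i = GiM i.D := rfl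

/-- the alias is p21's `rM`. [cite: Balaban1984PropagatorsII, (2.17) p.225, bookkeeping] -/
theorem rK_eq : rK i = rM i.D := rfl

/-- `R♯ = 1 − G′Q′*·(Q′G′²Q′*)⁻¹·Q′G′` on the Y carriers (p21's `rM = 1 − pM`, unfolded). [cite: Balaban1984PropagatorsII, (2.17) p.225, (2.69) p.235] -/
theorem rK_eq_one_sub : rK i = 1 - gpK i * qpsK i * xinvK i * qpK i * gpK i := rfl

/-- the alias is T8's kernel. [cite: Balaban1984PropagatorsII, (2.87) p.238, bookkeeping] -/
theorem cK_eq (s s' : BlkY i) : cK i s s' = (CinvTP (toKT i)).ker s s' := rfl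

/-- the alias is T8's `XopT`. [cite: Balaban1984PropagatorsII, (2.69) p.235, bookkeeping] -/
theorem XopEY_eq : XopEY i = XopT (toKT i) := rfl

/-- the alias is T8's `GinvT`. [cite: Balaban1984PropagatorsII, (2.86) p.238, bookkeeping] -/
theorem XinvEY_eq : XinvEY i = GinvT i.D (aPrinted ℓ 1) := rfl

/-- the matrix of `Q′G′²Q′*` (p21's `toMatrix_XopT`). [cite: Balaban1984PropagatorsII, (2.69) p.235] -/
theorem toMatrix_XopEY : LinearMap.toMatrix' (XopEY i) = qpK i * gpK i * gpK i * qpsK i := toMatrix_XopT i.D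

/-- the matrix of `(Q′G′²Q′*)⁻¹` (p21's `toMatrix_GinvT`). [cite: Balaban1984PropagatorsII, (2.86) p.238] -/
theorem toMatrix_XinvEY : LinearMap.toMatrix' (XinvEY i) = xinvK i := toMatrix_GinvT i.D

/-- `Q′G′²Q′*` is a unit ([4] p. 235 «its inverse is well defined»; T8's `XopT_isUnit`). [cite: Balaban1984PropagatorsII, p.235] -/
theorem XopEY_isUnit : IsUnit (XopEY i) := XopT_isUnit (toKT i) (one_le_ell i)

/-- `Q′G′²Q′* ∘ GinvT = 1` (T8's `XopT_mul_GinvT`). [cite: Balaban1984PropagatorsII, (2.86) p.238] -/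
theorem XopEY_comp_XinvEY : XopEY i ∘ₗ XinvEY i = LinearMap.id := XopT_mul_GinvT (toKT i) (one_le_ell i)

/-- the C kernel is `η^{−4−(d+1)}`-rescaled `GiM ∕ W`: `C♯(s,s′) = GiM(s,s′)·(n^{4+(d+1)} ∕ W(s′))`. [cite: Balaban1984PropagatorsII, (2.87) p.238] -/
theorem cK_eq_xinvK_mul (s s' : BlkY i) : cK i s s' = xinvK i s s' * ((((nKT (toKT i) : ℕ) : ℝ)) ^ (4 + (d + 1)) / W i.D.toDomains s') := by
  have h : cK i s s' = (((nKT (toKT i) : ℕ) : ℝ)) ^ (4 + (d + 1)) * (xinvK i s s' / W i.D.toDomains s') := rfl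
  rw [h]
  ring

/-- the corner site of a block of `𝔅`, as a site of the box chart (the reference point of the block's transports).
[cite: Balaban1985BackgroundPropagators, (3.21) p.394 («Γ_{y,x}»), dictionary] -/
def blkCornerY (s : BlkY i) : SiteY i := ⟨corner i.D.toDomains s, corner_mem i.D.toDomains s⟩

open Classical in
/-- transporter assignment of the COVARIANT GRADIENT (3.3): the forward leg `λ(b₊)` is transported by `U(b)`, the leg `λ(b₋)` by `1`.
[cite: Balaban1985BackgroundPropagators, (3.3) p.390] -/
def gradT (U : CfgY 𝔸 i) : FBondY i → SiteY i → 𝔸ˣ := fun b z => if z = boxEquiv i.hN b.tgt then U b.dir b.src else 1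

open Classical in
/-- transporter assignment of the COVARIANT CURL (3.4) on `p = ⟨x, x+e_μ, x+e_μ+e_ν, x+e_ν⟩`: `A(x+e_μ, ν)` is transported by `U(x, x+e_μ)`,
`A(x+e_ν, μ)` by `U(x, x+e_ν)`, the two bonds at `x` by `1`. [cite: Balaban1985BackgroundPropagators, (3.4) p.391] -/
def curlT (U : CfgY 𝔸 i) : PlaqY i → FBondY i → 𝔸ˣ := fun p b =>
  if b = ⟨p.src.shift p.μ, p.ν⟩ then U p.μ p.src else if b = ⟨p.src.shift p.ν, p.μ⟩ then U p.ν p.src else 1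

/-- transporter assignment of the COVARIANT BOND AVERAGING (3.12)–(3.14): the fine bond `b` is transported to the initial point of the coarse bond
along the member's contour transporter `parB`. [cite: Balaban1985BackgroundPropagators, (3.12)–(3.14) p.393] -/
def qT (parB : BondParY 𝔸 i) (U : CfgY 𝔸 i) : IBondY i → FBondY i → 𝔸ˣ := fun ι b => parB U (embIter (ι.1.1 : ℕ) ι.1.2.src) b.src

/-- transporter assignment of the COVARIANT BLOCK AVERAGING `Q′(U)` (3.21): the site `z` is transported to its block along `parS` («U(Γ_{y,x})»).
[cite: Balaban1985BackgroundPropagators, (3.21) p.394] -/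
def qpT (parS : SiteParY 𝔸 i) (U : CfgY 𝔸 i) : BlkY i → SiteY i → 𝔸ˣ := fun s z => parS U (blkCornerY i s) z

/-! ## §3 The covariant letters `D_U`, `D*_U` (both sectors), `Q(U)`, `Q*(U)`, `Q′(U)`, `Q′*(U)`, the Hessian `Δ(U)` of (3.10) -/

/-- ★ the COVARIANT GRADIENT `D_U : sites → bonds`, `(D_Uλ)(b) = c_f·(R(U(b))λ(b₊) − λ(b₋))`. [cite: Balaban1985BackgroundPropagators, (3.3) p.390] -/
def gradY (U : CfgY 𝔸 i) : (SiteY i → 𝔸) →ₗ[ℂ] (FBondY i → 𝔸) := trLiftY (gradK i) (gradT i U)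

/-- ★ the COVARIANT DIVERGENCE `D*_U : bonds → sites` (the adjoint of `D_U` for the trace pairings: transposed kernel, inverted transporters).
[cite: Balaban1985BackgroundPropagators, (3.8) p.392] -/
def divY (U : CfgY 𝔸 i) : (FBondY i → 𝔸) →ₗ[ℂ] (SiteY i → 𝔸) := trLiftY (divK i) fun z b => (gradT i U b z)⁻¹

/-- ★ the COVARIANT CURL `D_U : bonds → plaquettes` (3.4). [cite: Balaban1985BackgroundPropagators, (3.4) p.391] -/
def curlY (U : CfgY 𝔸 i) : (FBondY i → 𝔸) →ₗ[ℂ] (PlaqY i → 𝔸) := trLiftY (curlK i) (curlT i U)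

/-- ★ the COVARIANT CO-CURL `D*_U : plaquettes → bonds` (3.9) (adjoint of the curl for the trace pairings).
[cite: Balaban1985BackgroundPropagators, (3.9) p.392] -/
def coCurlY (U : CfgY 𝔸 i) : (PlaqY i → 𝔸) →ₗ[ℂ] (FBondY i → 𝔸) := trLiftY (cocurlK i) fun b p => (curlT i U p b)⁻¹

/-- ★ the COVARIANT AVERAGING `Q(U) : bonds → coarse bonds` (3.12)–(3.14). [cite: Balaban1985BackgroundPropagators, (3.12)–(3.14) p.393] -/
def QY (parB : BondParY 𝔸 i) (U : CfgY 𝔸 i) : (FBondY i → 𝔸) →ₗ[ℂ] (IBondY i → 𝔸) := trLiftY (qK i) (qT i parB U)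

/-- ★ `Q*(U) : coarse bonds → bonds`, the adjoint of `Q(U)`. [cite: Balaban1985BackgroundPropagators, (3.13) p.393] -/
def QsY (parB : BondParY 𝔸 i) (U : CfgY 𝔸 i) : (IBondY i → 𝔸) →ₗ[ℂ] (FBondY i → 𝔸) := trLiftY (qsK i) fun b ι => (qT i parB U ι b)⁻¹

/-- the weight operator `a` on coarse-bond functions (no transport). [cite: Balaban1985BackgroundPropagators, (3.26) p.395] -/
def aY : (IBondY i → 𝔸) →ₗ[ℂ] (IBondY i → 𝔸) := liftMatY 𝔸 (aK i)

/-- ★ the COVARIANT BLOCK AVERAGING `Q′(U) : sites → blocks` (3.21) (flat kernel p21's `QM`). [cite: Balaban1985BackgroundPropagators, (3.21) p.394] -/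
def QpY (parS : SiteParY 𝔸 i) (U : CfgY 𝔸 i) : (SiteY i → 𝔸) →ₗ[ℂ] (BlkY i → 𝔸) := trLiftY (qpK i) (qpT i parS U)

/-- ★ `Q′*(U) : blocks → sites`, the adjoint of `Q′(U)` for the (2.69) pairings (flat kernel p21's `QsM`). [cite: Balaban1985BackgroundPropagators, (3.24)–(3.25) p.395] -/
def QpsY (parS : SiteParY 𝔸 i) (U : CfgY 𝔸 i) : (BlkY i → 𝔸) →ₗ[ℂ] (SiteY i → 𝔸) := trLiftY (qpsK i) fun z s => (qpT i parS U s z)⁻¹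

/-- ★ (3.8) BY NAME: `D*_U` is the transported lift of the TRANSPOSED gradient kernel along the INVERTED gradient transporters
(`R(U(x, x−ηe_μ)) = R(U(⟨x−ηe_μ, x⟩))⁻¹`). [cite: Balaban1985BackgroundPropagators, (3.8) p.392] -/
theorem divY_eq_transpose (U : CfgY 𝔸 i) : divY i U = trLiftY (gradK i)ᵀ fun z b => (gradT i U b z)⁻¹ := by
  rw [← divK_eq_transpose]; rfl

/-- ★ (3.9) BY NAME: the co-curl is the transported lift of the transposed curl kernel along the inverted curl transporters.
[cite: Balaban1985BackgroundPropagators, (3.9) p.392] -/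
theorem coCurlY_eq_transpose (U : CfgY 𝔸 i) : coCurlY i U = trLiftY (curlK i)ᵀ fun b p => (curlT i U p b)⁻¹ := by
  rw [← cocurlK_eq_transpose]; rfl

/-- ★ (3.13) BY NAME: `Q*(U)` is the transported lift of the transposed `Q` kernel along the inverted `Q` transporters.
[cite: Balaban1985BackgroundPropagators, (3.13) p.393] -/
theorem QsY_eq_transpose (parB : BondParY 𝔸 i) (U : CfgY 𝔸 i) :
    QsY i parB U = trLiftY (qK i)ᵀ fun b ι => (qT i parB U ι b)⁻¹ := by
  rw [← qsK_eq_transpose]; rfl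

/-- the PLAQUETTE HOLONOMY `U(∂p) = U(x, y)U(y, z)U(z, w)U(w, x)`, `p = ⟨x, y, z, w⟩ = ⟨x, x+e_μ, x+e_μ+e_ν, x+e_ν⟩`.
[cite: Balaban1985BackgroundPropagators, (3.1) p.390] -/
def holY (U : CfgY 𝔸 i) (p : PlaqY i) : 𝔸ˣ := U p.μ p.src * U p.ν (p.src.shift p.μ) * (U p.μ (p.src.shift p.ν))⁻¹ * (U p.ν p.src)⁻¹

/-- `Re U(∂p) = ½(U(∂p) + U(−∂p))`, `U(−∂p) = U(∂p)⁻¹` (print's complexified reading). [cite: Balaban1985BackgroundPropagators, (3.7) p.391] -/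
def reHolY (U : CfgY 𝔸 i) (p : PlaqY i) : 𝔸 := (1 / 2 : ℂ) • ((holY i U p : 𝔸) + ((holY i U p)⁻¹ : 𝔸ˣ))

/-- `Im U(∂p) = (1/2i)(U(∂p) − U(−∂p))`. [cite: Balaban1985BackgroundPropagators, (3.7) p.391] -/
def imHolY (U : CfgY 𝔸 i) (p : PlaqY i) : 𝔸 := (-Complex.I / 2) • ((holY i U p : 𝔸) - ((holY i U p)⁻¹ : 𝔸ˣ))

/-- the plaquette-wise JORDAN INSERTION of the Hessian: `(𝒦_U F)(p) = ½(F(p)·Re U(∂p) + Re U(∂p)·F(p))` — the operator of the polarised first term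
`tr((D_U A)(p))²·Re U(∂p)` of (3.7)∕(3.10) for the trace pairing. [cite: Balaban1985BackgroundPropagators, (3.7) p.391, (3.10) p.392, dictionary] -/
def jordanY (U : CfgY 𝔸 i) : (PlaqY i → 𝔸) →ₗ[ℂ] (PlaqY i → 𝔸) :=
  (1 / 2 : ℂ) • LinearMap.pi fun p => (LinearMap.mulRight ℂ (reHolY i U p) + LinearMap.mulLeft ℂ (reHolY i U p)) ∘ₗ LinearMap.proj p

/-- the four bonds of the oriented contour `∂(p)_z = ⟨z, w⟩ ∪ ⟨w, x⟩ ∪ ⟨x, y⟩ ∪ ⟨y, z⟩` in print's order `≺` (as positively oriented bonds).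
[cite: Balaban1985BackgroundPropagators, (3.2) p.390] -/
def edgeY (p : PlaqY i) : Fin 4 → FBondY i := ![⟨p.src.shift p.ν, p.μ⟩, ⟨p.src, p.ν⟩, ⟨p.src, p.μ⟩, ⟨p.src.shift p.μ, p.ν⟩]

/-- the orientation signs of the contour bonds (`A(x, x′) = −A(x′, x)`, (3.5)): `⟨z, w⟩`, `⟨w, x⟩` reversed. [cite: Balaban1985BackgroundPropagators, (3.2), (3.5) pp.390–391] -/
def sgnY : Fin 4 → ℂ := ![-1, -1, 1, 1]

/-- the transporters of the primed variables `A′(z, w) = R(U(x, w))A(z, w)`, `A′(w, x) = A(w, x)`, `A′(x, y) = A(x, y)`, `A′(y, z) = R(U(x, y))A(y, z)`.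
[cite: Balaban1985BackgroundPropagators, (3.2) p.390] -/
def edgeParY (U : CfgY 𝔸 i) (p : PlaqY i) : Fin 4 → 𝔸ˣ := ![U p.ν p.src, 1, 1, U p.μ p.src]

/-- the primed contour variable `A′(b_m)`, `b_m ⊂ ∂(p)_z`, as a linear functional of `A`. [cite: Balaban1985BackgroundPropagators, (3.2) p.390] -/
def primeEdgeY (U : CfgY 𝔸 i) (p : PlaqY i) (m : Fin 4) : (FBondY i → 𝔸) →ₗ[ℂ] 𝔸 :=
  sgnY m • (RL (edgeParY i U p m) ∘ₗ LinearMap.proj (edgeY i p m))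

/-- the commutator insertion `X ↦ i(X·M − M·X) = i[X, M]`. [cite: Balaban1985BackgroundPropagators, (3.10) p.392, bookkeeping] -/
def commY (M : 𝔸) : 𝔸 →ₗ[ℂ] 𝔸 := Complex.I • (LinearMap.mulRight ℂ M - LinearMap.mulLeft ℂ M)

/-- ★ the COMMUTATOR PART `Δ′₂(U)` of the curvature operator `Δ′` of (3.10): the operator, for the trace pairing, of the polarised quadratic form
`Σ_p tr Σ_{b₁≺b₂} i[A′(b₁), A′(b₂)]·η⁻²Im U(∂p)`, i.e. `(Δ′₂A)(b) = ½ Σ_{(p,m): b_m = b} σ_m R(V_m)⁻¹ i[Σ_{l≻m}A′(b_l) − Σ_{l≺m}A′(b_l), c_f²·Im U(∂p)]`.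
[cite: Balaban1985BackgroundPropagators, (3.10) p.392, dictionary (operator of the form for ⟨X, Y⟩ = tr XY)] -/
def curv2Y (U : CfgY 𝔸 i) : (FBondY i → 𝔸) →ₗ[ℂ] (FBondY i → 𝔸) :=
  (1 / 2 : ℂ) • LinearMap.pi fun b => ∑ p : PlaqY i, ∑ m : Fin 4,
    if edgeY i p m = b then
      sgnY m • (RL (edgeParY i U p m)⁻¹ ∘ₗ commY (((i.cf ^ 2 : ℝ) : ℂ) • imHolY i U p) ∘ₗ
        (∑ l : Fin 4, (if m < l then primeEdgeY i U p l else 0) - ∑ l : Fin 4, (if l < m then primeEdgeY i U p l else 0)))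
    else 0

/-- ★ **THE HESSIAN `Δ(U) = D*D + Δ′` OF (3.10)** as an operator for the trace pairing: `D*_U ∘ 𝒦_U ∘ D_U + Δ′₂(U)` (the `Re U(∂p)`-term of `Δ′`
polarises to the Jordan insertion between co-curl and curl, the `Im U(∂p)`-term to `Δ′₂`). [cite: Balaban1985BackgroundPropagators, (3.10) p.392, dictionary] -/
def hessY (U : CfgY 𝔸 i) : (FBondY i → 𝔸) →ₗ[ℂ] (FBondY i → 𝔸) := coCurlY i U ∘ₗ jordanY i U ∘ₗ curlY i U + curv2Y i U

/-! ## §4 `(Q′G′²Q′*)(U)`, its inverse, the projection `R(U)` (3.25), the letter `C(U)` (3.48), `Δ_a(U)` (3.26) and `G(U) = Δ_a(U)⁻¹` -/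

/-- `(Q′G′²Q′*)(U)` on block functions (lattice units). [cite: Balaban1985BackgroundPropagators, (3.25) p.395] -/
def XY (parS : SiteParY 𝔸 i) (Gp : SiteOpY 𝔸 i) (U : CfgY 𝔸 i) : (BlkY i → 𝔸) →ₗ[ℂ] (BlkY i → 𝔸) :=
  QpY i parS U ∘ₗ Gp U ∘ₗ Gp U ∘ₗ QpsY i parS U

/-- `(Q′G′²Q′*)⁻¹(U)` (lattice units): `Ring.inverse`, the genuine inverse where `(Q′G′²Q′*)(U)` is invertible (Thm 3.2's regime), `0` elsewhere.
[cite: Balaban1985BackgroundPropagators, (3.25) p.395, Thm 3.2 p.398] -/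
def XinvY (parS : SiteParY 𝔸 i) (Gp : SiteOpY 𝔸 i) (U : CfgY 𝔸 i) : (BlkY i → 𝔸) →ₗ[ℂ] (BlkY i → 𝔸) := Ring.inverse (XY i parS Gp U)

/-- ★ **THE PROJECTION `R(U) = I − G′Q′*(Q′G′²Q′*)⁻¹Q′G′` OF (3.25)**. [cite: Balaban1985BackgroundPropagators, (3.25) p.395] -/
def RY (parS : SiteParY 𝔸 i) (Gp : SiteOpY 𝔸 i) (U : CfgY 𝔸 i) : (SiteY i → 𝔸) →ₗ[ℂ] (SiteY i → 𝔸) :=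
  LinearMap.id - Gp U ∘ₗ QpsY i parS U ∘ₗ XinvY i parS Gp U ∘ₗ QpY i parS U ∘ₗ Gp U

/-- the kernel-reading weights of the block sector in print's units: `η^{−4}` (from `G′ ↦ η²G′`) over the (2.69) pairing weight `(L^{j′}η)^{d+1}`, i.e.
`η^{−4−(d+1)}/(L^{j′})^{d+1}`, `η⁻¹ = L^k`. [cite: Balaban1985BackgroundPropagators, (3.48) p.398; Balaban1984PropagatorsII, (2.69) p.235, dictionary] -/
def cWtY : BlkY i → ℝ := fun s => (((nKT (toKT i) : ℕ) : ℝ)) ^ (4 + (d + 1)) / W i.D.toDomains s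

/-- ★ **THE LETTER `C(U)`**: the operator whose delta-matrix is the (3.48)-KERNEL `(Q′G′²Q′*)⁻¹(U; y, y′)` in print's units — the lattice inverse read
against the block pairing. [cite: Balaban1985BackgroundPropagators, (3.48) p.398, (3.25) p.395] -/
def CY (parS : SiteParY 𝔸 i) (Gp : SiteOpY 𝔸 i) (U : CfgY 𝔸 i) : (BlkY i → 𝔸) →ₗ[ℂ] (BlkY i → 𝔸) :=
  XinvY i parS Gp U ∘ₗ liftMatY 𝔸 (Matrix.diagonal (cWtY i))

/-- ★ **`Δ_a(U) = Δ(U) + D_U R(U) D*_U + Q*(U) a Q(U)` — (3.26)**. [cite: Balaban1985BackgroundPropagators, (3.26) p.395] -/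
def deltaAY (parS : SiteParY 𝔸 i) (parB : BondParY 𝔸 i) (Gp : SiteOpY 𝔸 i) (U : CfgY 𝔸 i) : (FBondY i → 𝔸) →ₗ[ℂ] (FBondY i → 𝔸) :=
  hessY i U + gradY i U ∘ₗ RY i parS Gp U ∘ₗ divY i U + QsY i parB U ∘ₗ aY i ∘ₗ QY i parB U

/-- ★ **`G(U) = Δ_a(U)⁻¹` — (3.27)**, total in `Module.End ℂ`: the genuine inverse where `Δ_a(U)` is invertible (Thm 3.1's regime), `0` elsewhere.
[cite: Balaban1985BackgroundPropagators, (3.27) p.395 («G(U) = Δ_a(U)⁻¹»), Thm 3.3 p.399] -/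
def GAY (parS : SiteParY 𝔸 i) (parB : BondParY 𝔸 i) (Gp : SiteOpY 𝔸 i) : BondOpY 𝔸 i := fun U => Ring.inverse (deltaAY i parS parB Gp U)

end Letters

/-! ## §5 At `U = 1`: every transporter is `1`, the letters are the lifts of r03's ∕ p21's operators of (2.19), (2.17), (2.69)–(2.87) -/

section AtOne

variable (i : KIdx d ℓ hd hL b₀ b₁)

/-- at `U = 1` the gradient's transporters are `1`. [cite: Balaban1985BackgroundPropagators, p.395 («It coincides with Δ_a in (2.19) if U = 1»), bookkeeping] -/
theorem gradT_one (b : FBondY i) (z : SiteY i) : gradT (𝔸 := 𝔸) i (fun _ _ => 1) b z = 1 := by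
  unfold gradT; split_ifs <;> rfl

/-- at `U = 1` the curl's transporters are `1`. [cite: Balaban1985BackgroundPropagators, p.395, bookkeeping] -/
theorem curlT_one (p : PlaqY i) (b : FBondY i) : curlT (𝔸 := 𝔸) i (fun _ _ => 1) p b = 1 := by
  unfold curlT; split_ifs <;> rfl

/-- at `U = 1` the averaging transporters are `1` (given the member's `parB_one`). [cite: Balaban1985BackgroundPropagators, p.395, bookkeeping] -/
theorem qT_one {parB : BondParY 𝔸 i} (hparB : ∀ s s', parB (fun _ _ => 1) s s' = 1) (ι : IBondY i) (b : FBondY i) :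
    qT i parB (fun _ _ => 1) ι b = 1 := hparB _ _

/-- at `U = 1` the block-averaging transporters are `1` (given the member's `parS_one`). [cite: Balaban1985BackgroundPropagators, p.395, bookkeeping] -/
theorem qpT_one {parS : SiteParY 𝔸 i} (hparS : ∀ z w, parS (fun _ _ => 1) z w = 1) (s : BlkY i) (z : SiteY i) :
    qpT i parS (fun _ _ => 1) s z = 1 := hparS _ _

/-- `D_1 = ∂♯`. [cite: Balaban1985BackgroundPropagators, p.395 («It coincides with Δ_a in (2.19) if U = 1»)] -/
theorem gradY_one : gradY (𝔸 := 𝔸) i (fun _ _ => 1) = liftMatY 𝔸 (gradK i) :=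
  trLiftY_eq_liftMatY_of_one 𝔸 (gradT_one i)

/-- `D*_1 = ∂*♯`. [cite: Balaban1985BackgroundPropagators, p.395] -/
theorem divY_one : divY (𝔸 := 𝔸) i (fun _ _ => 1) = liftMatY 𝔸 (divK i) :=
  trLiftY_eq_liftMatY_of_one 𝔸 fun z b => by rw [gradT_one, inv_one]

/-- the curl at `U = 1` is `∂♯`. [cite: Balaban1985BackgroundPropagators, p.395] -/
theorem curlY_one : curlY (𝔸 := 𝔸) i (fun _ _ => 1) = liftMatY 𝔸 (curlK i) :=
  trLiftY_eq_liftMatY_of_one 𝔸 (curlT_one i)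

/-- the co-curl at `U = 1` is `∂*♯`. [cite: Balaban1985BackgroundPropagators, p.395] -/
theorem coCurlY_one : coCurlY (𝔸 := 𝔸) i (fun _ _ => 1) = liftMatY 𝔸 (cocurlK i) :=
  trLiftY_eq_liftMatY_of_one 𝔸 fun b p => by rw [curlT_one, inv_one]

/-- `Q(1) = Q♯`. [cite: Balaban1985BackgroundPropagators, p.395] -/
theorem QY_one {parB : BondParY 𝔸 i} (hparB : ∀ s s', parB (fun _ _ => 1) s s' = 1) : QY i parB (fun _ _ => 1) = liftMatY 𝔸 (qK i) :=
  trLiftY_eq_liftMatY_of_one 𝔸 (qT_one i hparB)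

/-- `Q*(1) = Q*♯`. [cite: Balaban1985BackgroundPropagators, p.395] -/
theorem QsY_one {parB : BondParY 𝔸 i} (hparB : ∀ s s', parB (fun _ _ => 1) s s' = 1) : QsY i parB (fun _ _ => 1) = liftMatY 𝔸 (qsK i) :=
  trLiftY_eq_liftMatY_of_one 𝔸 fun b ι => by rw [qT_one i hparB, inv_one]

/-- `Q′(1) = Q′♯` (p21's `QM`). [cite: Balaban1985BackgroundPropagators, p.395; Balaban1984PropagatorsII, (2.14) p.225] -/
theorem QpY_one {parS : SiteParY 𝔸 i} (hparS : ∀ z w, parS (fun _ _ => 1) z w = 1) : QpY i parS (fun _ _ => 1) = liftMatY 𝔸 (qpK i) :=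
  trLiftY_eq_liftMatY_of_one 𝔸 (qpT_one i hparS)

/-- `Q′*(1) = Q′*♯` (p21's `QsM`). [cite: Balaban1985BackgroundPropagators, p.395; Balaban1984PropagatorsII, (2.69) p.235] -/
theorem QpsY_one {parS : SiteParY 𝔸 i} (hparS : ∀ z w, parS (fun _ _ => 1) z w = 1) : QpsY i parS (fun _ _ => 1) = liftMatY 𝔸 (qpsK i) :=
  trLiftY_eq_liftMatY_of_one 𝔸 fun z s => by rw [qpT_one i hparS, inv_one]

/-- the flat holonomy is `1`. [cite: Balaban1985BackgroundPropagators, (3.10) p.392 («Δ′ … small»: zero at U = 1), bookkeeping] -/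
theorem holY_one (p : PlaqY i) : holY (𝔸 := 𝔸) i (fun _ _ => 1) p = 1 := by
  simp [holY]

/-- `Re U(∂p) = 1` at `U = 1`. [cite: Balaban1985BackgroundPropagators, (3.7) p.391, bookkeeping] -/
theorem reHolY_one (p : PlaqY i) : reHolY (𝔸 := 𝔸) i (fun _ _ => 1) p = 1 := by
  rw [reHolY, holY_one, inv_one, Units.val_one, ← two_smul ℂ (1 : 𝔸), smul_smul]
  norm_num

/-- `Im U(∂p) = 0` at `U = 1`. [cite: Balaban1985BackgroundPropagators, (3.7) p.391, bookkeeping] -/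
theorem imHolY_one (p : PlaqY i) : imHolY (𝔸 := 𝔸) i (fun _ _ => 1) p = 0 := by
  rw [imHolY, holY_one, inv_one, Units.val_one, sub_self, smul_zero]

/-- the Jordan insertion is the identity at `U = 1`. [cite: Balaban1985BackgroundPropagators, (3.10) p.392, bookkeeping] -/
theorem jordanY_one : jordanY (𝔸 := 𝔸) i (fun _ _ => 1) = LinearMap.id := by
  refine LinearMap.ext fun F => funext fun p => ?_
  simp only [jordanY, LinearMap.smul_apply, Pi.smul_apply, LinearMap.pi_apply, LinearMap.comp_apply, LinearMap.proj_apply,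
    LinearMap.add_apply, LinearMap.mulRight_apply, LinearMap.mulLeft_apply, reHolY_one, mul_one, one_mul, LinearMap.id_apply]
  rw [← two_smul ℂ (F p), smul_smul]
  norm_num

omit [CompleteSpace 𝔸] in
/-- the commutator insertion with `0` vanishes. [cite: Balaban1985BackgroundPropagators, (3.10) p.392, bookkeeping] -/
theorem commY_zero : commY (0 : 𝔸) = 0 := by
  simp [commY]

/-- **the curvature operator `Δ′₂` VANISHES at `U = 1`** («generalizing the operator ∂*∂»). [cite: Balaban1985BackgroundPropagators, (3.10) p.392] -/
theorem curv2Y_one : curv2Y (𝔸 := 𝔸) i (fun _ _ => 1) = 0 := by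
  refine LinearMap.ext fun A => funext fun b => ?_
  simp [curv2Y, imHolY_one, commY_zero]

/-- **the Hessian at `U = 1` is `∂*∂`** (composition of the lifts of the flat co-curl and curl kernels). [cite: Balaban1985BackgroundPropagators, (3.10) p.392, p.395] -/
theorem hessY_one : hessY (𝔸 := 𝔸) i (fun _ _ => 1) = liftMatY 𝔸 (cocurlK i) ∘ₗ liftMatY 𝔸 (curlK i) := by
  rw [hessY, jordanY_one, curv2Y_one, add_zero, LinearMap.id_comp, coCurlY_one, curlY_one]

variable {i} in
/-- a `Gp` letter with the printed clause IS the lift of `G′♯` as an operator. [cite: Balaban1985BackgroundPropagators, p.395 + Cor. 3.5 p.407, bookkeeping] -/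
theorem Gp_one_eq_liftMatY {Gp : SiteOpY 𝔸 i} (hGp : ∀ (f : SiteY i → ℝ) (E : 𝔸), Gp (fun _ _ => 1) (liftY f E) = liftY ((toKT i).G *ᵥ f) E) :
    Gp (fun _ _ => 1) = liftMatY 𝔸 (gpK i) :=
  (eq_liftOpY_of_liftY hGp).trans rfl

/-- ★ **`(Q′G′²Q′*)(1)` IS THE LIFT OF NODE 00's `XopT`** (T8's genuine `Q′G′²Q′*` of the member's torus).
[cite: Balaban1985BackgroundPropagators, (3.25) p.395, Cor. 3.5 p.407 («for U = 1 … proved in [4]»); Balaban1984PropagatorsII, (2.69) p.235] -/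
theorem XY_one {parS : SiteParY 𝔸 i} {Gp : SiteOpY 𝔸 i} (hparS : ∀ z w, parS (fun _ _ => 1) z w = 1)
    (hGp : ∀ (f : SiteY i → ℝ) (E : 𝔸), Gp (fun _ _ => 1) (liftY f E) = liftY ((toKT i).G *ᵥ f) E) :
    XY i parS Gp (fun _ _ => 1) = liftEndY 𝔸 (XopEY i) := by
  rw [XY, QpY_one i hparS, QpsY_one i hparS, Gp_one_eq_liftMatY hGp, ← liftMatY_mul, ← liftMatY_mul, ← liftMatY_mul, liftEndY_eq_liftMatY,
    toMatrix_XopEY]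
  simp only [Matrix.mul_assoc]

/-- `(Q′G′²Q′*)(1)` on product forms. [cite: Balaban1985BackgroundPropagators, (3.25) p.395, bookkeeping] -/
theorem XY_one_liftY {parS : SiteParY 𝔸 i} {Gp : SiteOpY 𝔸 i} (hparS : ∀ z w, parS (fun _ _ => 1) z w = 1)
    (hGp : ∀ (f : SiteY i → ℝ) (E : 𝔸), Gp (fun _ _ => 1) (liftY f E) = liftY ((toKT i).G *ᵥ f) E) (f : BlkY i → ℝ) (E : 𝔸) :
    XY i parS Gp (fun _ _ => 1) (liftY f E) = liftY (XopEY i f) E := by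
  rw [XY_one i hparS hGp, liftEndY_liftY]

/-- ★ **`(Q′G′²Q′*)⁻¹(1)` IS THE LIFT OF T8's `GinvT`** (matrix `GiM`): the `Ring.inverse` is the genuine inverse at `U = 1` because `XopT` is a unit
(`XopT_isUnit`, [4] p. 235 «so its inverse is well defined»). [cite: Balaban1985BackgroundPropagators, (3.25) p.395, Cor. 3.5 p.407; Balaban1984PropagatorsII, (2.86)–(2.87) p.238] -/
theorem XinvY_one {parS : SiteParY 𝔸 i} {Gp : SiteOpY 𝔸 i} (hparS : ∀ z w, parS (fun _ _ => 1) z w = 1)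
    (hGp : ∀ (f : SiteY i → ℝ) (E : 𝔸), Gp (fun _ _ => 1) (liftY f E) = liftY ((toKT i).G *ᵥ f) E) :
    XinvY i parS Gp (fun _ _ => 1) = liftMatY 𝔸 (xinvK i) := by
  have h := eq_liftEndY_of_ringInverse (𝔸 := 𝔸) (O₁ := XinvY i parS Gp fun _ _ => 1) (Δ₁ := XY i parS Gp fun _ _ => 1)
    (T := XopEY i) (S := XinvEY i) rfl (XopEY_isUnit i) (XopEY_comp_XinvEY i) (XY_one_liftY i hparS hGp)
  rw [h, liftEndY_eq_liftMatY, toMatrix_XinvEY]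

/-- ★ **`R(1)` IS THE LIFT OF p21's `1 − P = rM`** (so, through gen-19's `RE_eq_rM_chart`, of Sect. A's projection `R` onto `ΔN(Q′)`).
[cite: Balaban1985BackgroundPropagators, (3.25) p.395 («It is the orthogonal projection…»); Balaban1984PropagatorsII, (2.17) p.225] -/
theorem RY_one {parS : SiteParY 𝔸 i} {Gp : SiteOpY 𝔸 i} (hparS : ∀ z w, parS (fun _ _ => 1) z w = 1)
    (hGp : ∀ (f : SiteY i → ℝ) (E : 𝔸), Gp (fun _ _ => 1) (liftY f E) = liftY ((toKT i).G *ᵥ f) E) :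
    RY i parS Gp (fun _ _ => 1) = liftMatY 𝔸 (rK i) := by
  rw [RY, XinvY_one i hparS hGp, QpY_one i hparS, QpsY_one i hparS, Gp_one_eq_liftMatY hGp, ← liftMatY_mul, ← liftMatY_mul, ← liftMatY_mul,
    ← liftMatY_mul, ← liftMatY_one 𝔸, ← liftMatY_sub, rK_eq_one_sub]
  simp only [Matrix.mul_assoc]

/-- ★ **`C(1)` IS THE BLOCK KERNEL OPERATOR OF T8's `CinvTP`** (the (2.87) kernel of `(Q′G′²Q′*)⁻¹` in print's units) — as operators.
[cite: Balaban1985BackgroundPropagators, (3.48) p.398, Cor. 3.5 p.407 («for U = 1 … proved in [4]»); Balaban1984PropagatorsII, (2.86)–(2.87) p.238] -/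
theorem CY_one {parS : SiteParY 𝔸 i} {Gp : SiteOpY 𝔸 i} (hparS : ∀ z w, parS (fun _ _ => 1) z w = 1)
    (hGp : ∀ (f : SiteY i → ℝ) (E : 𝔸), Gp (fun _ _ => 1) (liftY f E) = liftY ((toKT i).G *ᵥ f) E) :
    CY i parS Gp (fun _ _ => 1) = kernelOpY 𝔸 (cK i) := by
  rw [CY, XinvY_one i hparS hGp, ← liftMatY_mul, kernelOpY, liftOpY_eq_liftMatY]
  congr 1
  ext s s'
  rw [Matrix.mul_diagonal, Matrix.of_apply, cK_eq_xinvK_mul, cWtY]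

/-- ★ **THE CLAUSE `CovLettersY.C_one` DISCHARGED for the genuine letter**: `C(1)(δ_{s′} ⊗ E)(s) = CinvTP(s, s′) • E`.
[cite: Balaban1985BackgroundPropagators, (3.48) p.398, Cor. 3.5 p.407] -/
theorem CY_one_deltaY {parS : SiteParY 𝔸 i} {Gp : SiteOpY 𝔸 i} (hparS : ∀ z w, parS (fun _ _ => 1) z w = 1)
    (hGp : ∀ (f : SiteY i → ℝ) (E : 𝔸), Gp (fun _ _ => 1) (liftY f E) = liftY ((toKT i).G *ᵥ f) E) (s s' : BlkY i) (E : 𝔸) :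
    CY i parS Gp (fun _ _ => 1) (deltaY s' E) s = (((CinvTP (toKT i)).ker s s' : ℝ) : ℂ) • E := by
  rw [CY_one i hparS hGp]
  exact kernelOpY_deltaY 𝔸 (cK i) s s' E

/-! ### The flat identity: the three terms of `Δ_a(1)` are r03's three terms of (2.19) -/

/-- the divergence kernel acts as r03's `∂*` read on the box: `(divK·A)(z) = (∂*A)(chart⁻¹ z)`. [cite: Balaban1985BackgroundPropagators, (3.8) p.392, bookkeeping] -/
theorem divK_mulVec (A : FBondY i → ℝ) :
    divK i *ᵥ A = fun z => onFun (dsE (P := PV d ℓ i.m i.K hd hL) i.cf) A ((boxEquiv i.hN).symm z) := by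
  funext z
  change (LinearMap.toMatrix' (onFun (dsE (P := PV d ℓ i.m i.K hd hL) i.cf)) *ᵥ A) ((boxEquiv i.hN).symm z) = _
  rw [LinearMap.toMatrix'_mulVec]

/-- the gradient kernel acts as r03's `∂` of the function read back through the chart: `gradK·h = ∂(h ∘ chart)`. [cite: Balaban1985BackgroundPropagators, (3.3) p.390, bookkeeping] -/
theorem gradK_mulVec (h : SiteY i → ℝ) :
    gradK i *ᵥ h = onFun (dE (P := PV d ℓ i.m i.K hd hL) i.cf) (fun x => h (boxEquiv i.hN x)) := by
  funext b
  rw [← LinearMap.toMatrix'_mulVec (onFun (dE (P := PV d ℓ i.m i.K hd hL) i.cf))]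
  change ∑ z, LinearMap.toMatrix' (onFun (dE (P := PV d ℓ i.m i.K hd hL) i.cf)) b ((boxEquiv i.hN).symm z) * h z = _
  simp only [Matrix.mulVec, dotProduct]
  exact (Fintype.sum_equiv (boxEquiv i.hN) _ _ fun x => by simp only [Equiv.symm_apply_apply]).symm

/-- r03's projection read on functions IS p21's `rM` through the chart (gen-19's `RE_eq_rM_chart`, operator form).
[cite: Balaban1984PropagatorsII, (2.17) p.225] -/
theorem onFun_RE_apply (g : Site (PV d ℓ i.m i.K hd hL) 0 → ℝ) (x : Site (PV d ℓ i.m i.K hd hL) 0) :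
    onFun (RE (domT i.hN i.D i.hk) i.cf) g x = (rM i.D *ᵥ fun z => g ((boxEquiv i.hN).symm z)) (toBox i.hN x) := by
  rw [onFun_apply, RE_eq_rM_chart i.hN i.D i.hk (one_le_ell i) (toKT i).hMh (toKT i).hP i.hcf]

/-- **the `∂R∂*` term at `U = 1`**: `gradK·(R♯·(divK·A)) = (∂ ∘ R ∘ ∂*)A`. [cite: Balaban1985BackgroundPropagators, (3.26) p.395; Balaban1984PropagatorsII, (2.19) p.226] -/
theorem gradK_rK_divK_mulVec (A : FBondY i → ℝ) :
    gradK i *ᵥ (rK i *ᵥ (divK i *ᵥ A)) =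
      onFun (dE (P := PV d ℓ i.m i.K hd hL) i.cf) (onFun (RE (domT i.hN i.D i.hk) i.cf) (onFun (dsE (P := PV d ℓ i.m i.K hd hL) i.cf) A)) := by
  rw [gradK_mulVec, divK_mulVec]
  congr 1
  funext x
  rw [onFun_RE_apply]
  rfl

/-- **THE FLAT IDENTITY**: r03's `Δ_a = ∂*∂ + ∂R∂* + Q*aQ` of (2.19) on bond functions IS the sum of the three flat kernel terms.
[cite: Balaban1984PropagatorsII, (2.19) p.226; Balaban1985BackgroundPropagators, p.395 («It coincides with Δ_a in (2.19) if U = 1»)] -/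
theorem onFun_deltaAE_eq (A : FBondY i → ℝ) :
    onFun (deltaAE (domT i.hN i.D i.hk) i.cf i.w) A =
      cocurlK i *ᵥ (curlK i *ᵥ A) + gradK i *ᵥ (rK i *ᵥ (divK i *ᵥ A)) + qsK i *ᵥ (aK i *ᵥ (qK i *ᵥ A)) := by
  rw [deltaAE_def, onFun_add, onFun_add, onFun_comp, onFun_comp, onFun_comp, onFun_comp, onFun_comp, gradK_rK_divK_mulVec]
  simp only [LinearMap.add_apply, LinearMap.comp_apply, cocurlK, curlK, qsK, aK, qK, LinearMap.toMatrix'_mulVec]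

/-- ★ **THE PRINTED IDENTIFICATION «Δ_a(U) coincides with Δ_a in (2.19) if U = 1» ON PRODUCT FORMS**: `Δ_a(1)(A ⊗ E) = (Δ_a A) ⊗ E` with r03's
`Δ_a = onFun (deltaAE (domT …) c_f w)` — the hypothesis `hΔ` of n06-g's engine `GA_one_of_ringInverse_deltaA_one`.
[cite: Balaban1985BackgroundPropagators, p.395 («It coincides with Δ_a in (2.19) if U = 1»)] -/
theorem deltaAY_one_liftY {parS : SiteParY 𝔸 i} {parB : BondParY 𝔸 i} {Gp : SiteOpY 𝔸 i} (hparS : ∀ z w, parS (fun _ _ => 1) z w = 1)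
    (hparB : ∀ s s', parB (fun _ _ => 1) s s' = 1)
    (hGp : ∀ (f : SiteY i → ℝ) (E : 𝔸), Gp (fun _ _ => 1) (liftY f E) = liftY ((toKT i).G *ᵥ f) E) (A : FBondY i → ℝ) (E : 𝔸) :
    deltaAY i parS parB Gp (fun _ _ => 1) (liftY A E) = liftY (onFun (deltaAE (domT i.hN i.D i.hk) i.cf i.w) A) E := by
  rw [deltaAY, LinearMap.add_apply, LinearMap.add_apply, hessY_one, gradY_one, divY_one, RY_one i hparS hGp, QsY_one i hparB, QY_one i hparB,
    aY]
  simp only [LinearMap.comp_apply, liftMatY_liftY]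
  rw [← liftY_add, ← liftY_add, onFun_deltaAE_eq]

/-- ★ **`Δ_a(1)` IS THE LIFT OF r03's `Δ_a`** as an operator. [cite: Balaban1985BackgroundPropagators, p.395 («It coincides with Δ_a in (2.19) if U = 1»)] -/
theorem deltaAY_one {parS : SiteParY 𝔸 i} {parB : BondParY 𝔸 i} {Gp : SiteOpY 𝔸 i} (hparS : ∀ z w, parS (fun _ _ => 1) z w = 1)
    (hparB : ∀ s s', parB (fun _ _ => 1) s s' = 1)
    (hGp : ∀ (f : SiteY i → ℝ) (E : 𝔸), Gp (fun _ _ => 1) (liftY f E) = liftY ((toKT i).G *ᵥ f) E) :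
    deltaAY i parS parB Gp (fun _ _ => 1) = liftEndY 𝔸 (onFun (deltaAE (domT i.hN i.D i.hk) i.cf i.w)) :=
  linearMap_ext_of_liftY fun A E => by rw [deltaAY_one_liftY i hparS hparB hGp, liftEndY_liftY]

/-- ★ **THE CLAUSE `CovLettersY.GA_one` DISCHARGED for the genuine letter** `G(U) = Ring.inverse (Δ_a(U))`: `G(1)(J ⊗ E) = (Gop J) ⊗ E` —
n06-g's engine on the product-form identification. [cite: Balaban1985BackgroundPropagators, (3.27) p.395 («G(U) = Δ_a(U)⁻¹»), p.395 + Cor. 3.5 p.407] -/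
theorem GAY_one_liftY {parS : SiteParY 𝔸 i} {parB : BondParY 𝔸 i} {Gp : SiteOpY 𝔸 i} (hparS : ∀ z w, parS (fun _ _ => 1) z w = 1)
    (hparB : ∀ s s', parB (fun _ _ => 1) s s' = 1)
    (hGp : ∀ (f : SiteY i → ℝ) (E : 𝔸), Gp (fun _ _ => 1) (liftY f E) = liftY ((toKT i).G *ᵥ f) E) (J : FBondY i → ℝ) (E : 𝔸) :
    GAY i parS parB Gp (fun _ _ => 1) (liftY J E) = liftY (Gop i J) E :=
  GA_one_of_ringInverse_deltaA_one i (GAY i parS parB Gp) (deltaAY i parS parB Gp) rfl (deltaAY_one_liftY i hparS hparB hGp) J E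

/-- ★ **`G(1)` IS THE LIFT OF r03's `Gop = Δ_a⁻¹`** as an operator (= the flat family's `GA`). [cite: Balaban1985BackgroundPropagators, (3.27) p.395, Cor. 3.5 p.407] -/
theorem GAY_one {parS : SiteParY 𝔸 i} {parB : BondParY 𝔸 i} {Gp : SiteOpY 𝔸 i} (hparS : ∀ z w, parS (fun _ _ => 1) z w = 1)
    (hparB : ∀ s s', parB (fun _ _ => 1) s s' = 1)
    (hGp : ∀ (f : SiteY i → ℝ) (E : 𝔸), Gp (fun _ _ => 1) (liftY f E) = liftY ((toKT i).G *ᵥ f) E) :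
    GAY i parS parB Gp (fun _ _ => 1) = liftEndY 𝔸 (Gop i) :=
  eq_liftEndY_Gop_of_ringInverse i (GAY i parS parB Gp) (deltaAY i parS parB Gp) rfl (deltaAY_one_liftY i hparS hparB hGp)

/-- `Δ_a(U)·G(U) = 1` wherever `Δ_a(U)` is invertible. [cite: Balaban1985BackgroundPropagators, (3.27) p.395 («G(U) = Δ_a(U)⁻¹»)] -/
theorem deltaAY_mul_GAY {parS : SiteParY 𝔸 i} {parB : BondParY 𝔸 i} {Gp : SiteOpY 𝔸 i} {U : CfgY 𝔸 i}
    (hU : IsUnit (deltaAY i parS parB Gp U)) : deltaAY i parS parB Gp U * GAY i parS parB Gp U = 1 :=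
  Ring.mul_inverse_cancel _ hU

/-- `G(U)·Δ_a(U) = 1` wherever `Δ_a(U)` is invertible. [cite: Balaban1985BackgroundPropagators, (3.27) p.395] -/
theorem GAY_mul_deltaAY {parS : SiteParY 𝔸 i} {parB : BondParY 𝔸 i} {Gp : SiteOpY 𝔸 i} {U : CfgY 𝔸 i}
    (hU : IsUnit (deltaAY i parS parB Gp U)) : GAY i parS parB Gp U * deltaAY i parS parB Gp U = 1 :=
  Ring.inverse_mul_cancel _ hU

/-- `Δ_a(1)` is invertible (it lifts r03's bijective `Δ_a`). [cite: Balaban1985BackgroundPropagators, Thm 3.3 p.399 (U = 1 case = [4]), bookkeeping] -/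
theorem isUnit_deltaAY_one {parS : SiteParY 𝔸 i} {parB : BondParY 𝔸 i} {Gp : SiteOpY 𝔸 i} (hparS : ∀ z w, parS (fun _ _ => 1) z w = 1)
    (hparB : ∀ s s', parB (fun _ _ => 1) s s' = 1)
    (hGp : ∀ (f : SiteY i → ℝ) (E : 𝔸), Gp (fun _ _ => 1) (liftY f E) = liftY ((toKT i).G *ᵥ f) E) :
    IsUnit (deltaAY i parS parB Gp (fun _ _ => 1)) := by
  rw [deltaAY_one i hparS hparB hGp]
  exact B9Cor35AtOneInverseLetters.isUnit_liftEndY 𝔸 (B9Cor35AtOneInverseLetters.isUnit_onFun_deltaAE i)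

end AtOne

/-! ## §6 The record update `CovLettersY.withGAC` and def-Y's v2 family at a member -/

section Upgrade

variable (𝔸) {x : MemberY d ℓ hd hL b₀ b₁ Mstar}

/-- **REPLACING `GA` AND `C` BY THE GENUINE LETTERS** built over the record's own transporters `parS ∕ parB` and its `G′` letter `Gp`:
`GA := G(U) = Δ_a(U)⁻¹` (3.26)–(3.27), `C := (Q′G′²Q′*)⁻¹(U)` read as its (3.48)-kernel operator; the printed clauses follow from the record's
`parS_one ∕ parB_one ∕ Gp_one`. [cite: Balaban1985BackgroundPropagators, (3.25)–(3.27) p.395, (3.48) p.398, Cor. 3.5 p.407] -/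
def CovLettersY.withGAC (𝔏 : CovLettersY 𝔸 x) : CovLettersY 𝔸 x :=
  { 𝔏 with
    GA := GAY x.toKIdx 𝔏.parS 𝔏.parB 𝔏.Gp
    C := CY x.toKIdx 𝔏.parS 𝔏.Gp
    GA_one := GAY_one_liftY x.toKIdx 𝔏.parS_one 𝔏.parB_one 𝔏.Gp_one
    C_one := CY_one_deltaY x.toKIdx 𝔏.parS_one 𝔏.Gp_one }

variable {𝔸}
variable (𝔏 : CovLettersY 𝔸 x)

/-- the updated `GA` is `Δ_a(U)⁻¹`. [cite: Balaban1985BackgroundPropagators, (3.27) p.395, bookkeeping] -/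
theorem CovLettersY.withGAC_GA : (𝔏.withGAC 𝔸).GA = GAY x.toKIdx 𝔏.parS 𝔏.parB 𝔏.Gp := rfl

/-- the updated `C` is the genuine `(Q′G′²Q′*)⁻¹(U)` kernel operator. [cite: Balaban1985BackgroundPropagators, (3.48) p.398, bookkeeping] -/
theorem CovLettersY.withGAC_C : (𝔏.withGAC 𝔸).C = CY x.toKIdx 𝔏.parS 𝔏.Gp := rfl

/-- the update keeps `G′`. [cite: Balaban1985BackgroundPropagators, (3.25) p.395, bookkeeping] -/
theorem CovLettersY.withGAC_Gp : (𝔏.withGAC 𝔸).Gp = 𝔏.Gp := rfl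

/-- the update keeps the site transporter. [cite: Balaban1985BackgroundPropagators, (3.40) p.397, bookkeeping] -/
theorem CovLettersY.withGAC_parS : (𝔏.withGAC 𝔸).parS = 𝔏.parS := rfl

/-- the update keeps the bond transporter. [cite: Balaban1985BackgroundPropagators, (3.40) p.397, bookkeeping] -/
theorem CovLettersY.withGAC_parB : (𝔏.withGAC 𝔸).parB = 𝔏.parB := rfl

variable (𝔸) (x)

/-- ★ **def-Y's v2 LETTER FAMILY AT A MEMBER**: genuine taxicab transporters (`OpsYTransport`), genuine `G′(U) = Δ′_a(U)⁻¹` (`OpsYDeltaPrimeA`),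
genuine `G(U) = Δ_a(U)⁻¹` and `C(U) = (Q′G′²Q′*)⁻¹(U)` (this file); the Sect. D∕E letters (`GD, G₁, GG, Kdiff, H, H₁, Ck, QGQinv, QG1Qinv, P349`)
remain the flat `0` placeholders of `covLettersY_flat`. [cite: Balaban1985BackgroundPropagators, (3.25)–(3.27) p.395, (3.40) p.397, (3.48) p.398, Cor. 3.5 p.407] -/
def covLettersY_v2 : CovLettersY 𝔸 x := (covLettersY_TGp 𝔸 x).withGAC 𝔸

/-- its `GA` is the genuine `Δ_a(U)⁻¹` over the genuine transporters and `G′`. [cite: Balaban1985BackgroundPropagators, (3.27) p.395, bookkeeping] -/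
theorem covLettersY_v2_GA :
    (covLettersY_v2 𝔸 x).GA = GAY x.toKIdx (parSY x.toKIdx) (parBY x.toKIdx) (GpY x.toKIdx (parSY x.toKIdx)) := rfl

/-- its `C` is the genuine `(Q′G′²Q′*)⁻¹(U)`. [cite: Balaban1985BackgroundPropagators, (3.48) p.398, bookkeeping] -/
theorem covLettersY_v2_C : (covLettersY_v2 𝔸 x).C = CY x.toKIdx (parSY x.toKIdx) (GpY x.toKIdx (parSY x.toKIdx)) := rfl

/-- its `G′` is p473950's `GpY`. [cite: Balaban1985BackgroundPropagators, (3.25) p.395, bookkeeping] -/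
theorem covLettersY_v2_Gp : (covLettersY_v2 𝔸 x).Gp = GpY x.toKIdx (parSY x.toKIdx) := rfl

/-- its transporters are the taxicab ones. [cite: Balaban1985BackgroundPropagators, (3.40) p.397, bookkeeping] -/
theorem covLettersY_v2_parS : (covLettersY_v2 𝔸 x).parS = parSY x.toKIdx := rfl

/-- its bond transporters are the taxicab ones. [cite: Balaban1985BackgroundPropagators, (3.40) p.397, bookkeeping] -/
theorem covLettersY_v2_parB : (covLettersY_v2 𝔸 x).parB = parBY x.toKIdx := rfl

end Upgrade

/-! ## §7 The letters and the `OpsY` instance OF RECORD -/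

section Record

open scoped Matrix.Norms.L2Operator

/-- ★ **THE LETTERS OF RECORD**: def-Y's v2 family at every member of Stage 3′(Y), `𝔸 = M_N(ℂ)`. [cite: Balaban1985BackgroundPropagators, (3.25)–(3.27) p.395, (3.48) p.398] -/
def lettersYOfRecord (N : ℕ) (θ : Stage3Params) (Mstar : ℕ) : LettersY N θ Mstar := fun x => covLettersY_v2 (Matrix (Fin N) (Fin N) ℂ) x

/-- ★ **THE `OpsY` INSTANCE OF RECORD** of Stage 3′(Y): `opsYOfLetters` at the letters of record (the predicate ∕ expansion letters `𝔈` are the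
n06-c ∕ n06-d pins' and stay a parameter). [cite: Balaban1985BackgroundPropagators, Thms 3.1–3.15 pp.397–432] -/
def opsYOfRecord (N : ℕ) (θ : Stage3Params) (Mstar : ℕ) (𝔈 : ExpsY N θ Mstar) : OpsY N θ Mstar :=
  opsYOfLetters N θ Mstar (lettersYOfRecord N θ Mstar) 𝔈

/-- the instance of record, unfolded. [cite: Balaban1985BackgroundPropagators, Thms 3.1–3.15 pp.397–432, bookkeeping] -/
theorem opsYOfRecord_eq (N : ℕ) (θ : Stage3Params) (Mstar : ℕ) (𝔈 : ExpsY N θ Mstar) :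
    opsYOfRecord N θ Mstar 𝔈 = opsYOfLetters N θ Mstar (lettersYOfRecord N θ Mstar) 𝔈 := rfl

/-- the letters of record at a member are the v2 family. [cite: Balaban1985BackgroundPropagators, (3.25)–(3.27) p.395, bookkeeping] -/
theorem lettersYOfRecord_apply (N : ℕ) (θ : Stage3Params) (Mstar : ℕ) (x : MemberY θ.d₆ θ.ℓ₆ θ.hd' θ.hL' θ.b₀ θ.b₁ Mstar) :
    lettersYOfRecord N θ Mstar x = covLettersY_v2 (Matrix (Fin N) (Fin N) ℂ) x := rfl

/-- the [B9] bundle of record at the instance of record. [cite: Balaban1985BackgroundPropagators, Thms 3.1–3.15 pp.397–432, bookkeeping] -/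
theorem Y9OfRecord_opsYOfRecord (N : ℕ) (θ : Stage3Params) (Mstar : ℕ) (𝔈 : ExpsY N θ Mstar) :
    Y9OfRecord N θ Mstar (opsYOfRecord N θ Mstar 𝔈) =
      carriersY θ.d₆ θ.ℓ₆ θ.hd' θ.hL' θ.b₀ θ.b₁ Mstar (Matrix (Fin N) (Fin N) ℂ) (specialUnitaryUnits (Fin N)) (opsYOfRecord N θ Mstar 𝔈) := rfl

end Record

end

end Literature.MathematicalPhysics.QuantumFieldTheory.Balaban1983to89.Node00
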